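import Literature.Probability.RandomPlanarGeometry.SLENoTracedLine
import HarnessLib

/-!
# No traced circle arcs: the cocircular-tracing event and the SLE_κ curve, `4 < κ < 8`

Topic `Probability/RandomPlanarGeometry`; theorems only (companion of `SLENoTracedLine`; regularity
of the chordal SLE₆ family for the refutation of crux `stmt-CriticalPhenomena-0698`: no round germ
at a stopped tip / no circle arc traced).

* `CurveClass.isClosed_setOf_subarc_sphere`, **`CurveClass.measurableSet_setOf_tracesCircle`** —
  the event "some representative maps a non-trivial parameter interval NON-CONSTANTLY into a
  circle `sphere m R`, `R > 0`" is Borel: the countable union over `n` of the CLOSED events with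
  bounded witnesses `‖m‖ ≤ n`, `1/(n+1) ≤ R ≤ n`, `1/(n+1) ≤ dist (c u) (c v)` (compact parameter
  ranges, so that witnesses have convergent subsequences; circles of unbounded radius degenerate
  to lines and are NOT in the event).
* **`IsSLECurve.ae_forall_not_subset_sphere`** — for an SLE_κ random curve in a Dobrushin
  domain, `4 < κ < 8`, almost surely the compactified image `c₀` of the trace has no sub-arc image
  `c₀ '' [s, t]`, `s < t`, inside a circle: on a piece `Φ(γ[a, b])` of diameter `< R` inside
  `sphere m R` the tangential coordinate at its initial point is a continuous real function
  injective on the piece (`Φ` injective on the closed half-plane), contradicting arc confinement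
  (`ae_not_injOn_sleTrace`).

References: S. Rohde, O. Schramm, *Basic properties of SLE*, Ann. of Math. 161 (2005), §7;
M. Aizenman, A. Burchard, Duke Math. J. 99 (1999), §2.1.
-/

noncomputable section

open Set Filter Topology MeasureTheory Metric

open scoped NNReal unitInterval

namespace Literature.Probability.RandomPlanarGeometry

/-! ### Injectivity of the tangential coordinate on a half circle -/

/-- **Two points of a circle on the same side of a diameter with equal tangential coordinate
coincide.** With `u = p₀ - m`, `‖u‖ = R`: if `q₁, q₂ ∈ sphere m R`, both at distance `< R` from
`p₀`... stated algebraically: `wᵢ = (qᵢ - m) * conj u` have equal imaginary parts, equal norms and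
positive real parts, hence are equal. [folklore] -/
theorem eq_of_tangential_eq {m u q₁ q₂ : ℂ} (hu : u ≠ 0)
    (hn : ‖q₁ - m‖ = ‖q₂ - m‖)
    (hre₁ : 0 < ((q₁ - m) * (starRingEnd ℂ) u).re) (hre₂ : 0 < ((q₂ - m) * (starRingEnd ℂ) u).re)
    (him : ((q₁ - m) * (starRingEnd ℂ) u).im = ((q₂ - m) * (starRingEnd ℂ) u).im) : q₁ = q₂ := by
  set w₁ : ℂ := (q₁ - m) * (starRingEnd ℂ) u with hw₁
  set w₂ : ℂ := (q₂ - m) * (starRingEnd ℂ) u with hw₂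
  have hnorm : ‖w₁‖ = ‖w₂‖ := by
    simp only [hw₁, hw₂, norm_mul, hn]
  have hsq : w₁.re * w₁.re + w₁.im * w₁.im = w₂.re * w₂.re + w₂.im * w₂.im := by
    have h1 : Complex.normSq w₁ = Complex.normSq w₂ := by
      rw [Complex.normSq_eq_norm_sq, Complex.normSq_eq_norm_sq, hnorm]
    rwa [Complex.normSq_apply, Complex.normSq_apply] at h1
  have hre : w₁.re = w₂.re := by
    have h2 : w₁.re * w₁.re = w₂.re * w₂.re := by rw [him] at hsq; linarith
    nlinarith [hre₁, hre₂]
  have hw : w₁ = w₂ := Complex.ext hre him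
  have hcu : (starRingEnd ℂ) u ≠ 0 := by simpa using hu
  have h3 : q₁ - m = q₂ - m := mul_right_cancel₀ hcu hw
  simpa using h3

/-- On a circle, a point at distance `< R` from `p₀ = m + u` (`‖u‖ = R`) has positive
`u`-coordinate: `0 < Re((q - m) conj u)`. [folklore] -/
theorem re_pos_of_dist_lt {m u q : ℂ} {R : ℝ} (hu : ‖u‖ = R) (hq : ‖q - m‖ = R)
    (hd : dist q (m + u) < R) : 0 < ((q - m) * (starRingEnd ℂ) u).re := by
  have hexp : dist q (m + u) ^ 2 = ‖q - m‖ ^ 2 + ‖u‖ ^ 2 - 2 * ((q - m) * (starRingEnd ℂ) u).re := by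
    rw [dist_eq_norm, show q - (m + u) = (q - m) - u by ring, ← Complex.normSq_eq_norm_sq,
      ← Complex.normSq_eq_norm_sq, ← Complex.normSq_eq_norm_sq, Complex.normSq_sub]
  have hR : 0 ≤ R := by rw [← hu]; exact norm_nonneg _
  have hd2 : dist q (m + u) ^ 2 < R ^ 2 := by
    exact pow_lt_pow_left₀ hd dist_nonneg two_ne_zero
  rw [hexp, hq, hu] at hd2
  nlinarith

/-! ### The cocircular-tracing event is Borel -/

section TracingEvent

/-- **The quantitative cocircular-tracing event is closed** (bounded witnesses): classes with a
representative `c`, `s ≤ t`, a centre `‖m‖ ≤ n` and a radius `R ∈ [1/(n+1), n]` with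
`c '' [s, t] ⊆ sphere m R` and `1/(n+1) ≤ dist (c u) (c v)` for some `u, v ∈ [s, t]`.
[cite: AizenmanBurchard1999, §2.1] -/
theorem CurveClass.isClosed_setOf_subarc_sphere (n : ℕ) :
    IsClosed {γ : CurveClass ℂ | ∃ c : Curve ℂ, CurveClass.mk c = γ ∧ ∃ s t : I, s ≤ t ∧
      ∃ m : ℂ, ‖m‖ ≤ n ∧ ∃ R : ℝ, R ∈ Icc (1 / ((n : ℝ) + 1)) n ∧
      (∀ w ∈ Icc s t, dist (c w) m = R) ∧
      ∃ u ∈ Icc s t, ∃ v ∈ Icc s t, 1 / ((n : ℝ) + 1) ≤ dist (c u) (c v)} := by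
  refine IsSeqClosed.isClosed fun x γ hx hlim ↦ ?_
  obtain ⟨c, rfl⟩ := CurveClass.surjective_mk γ
  choose c' hmk s t hst m hm R hR hsph u hu v hv hε using hx
  -- sup-close reparametrisations of the representatives `c' k`
  have hdist : Tendsto (fun k ↦ dist c (c' k)) atTop (𝓝 0) := by
    refine (tendsto_iff_dist_tendsto_zero.1 hlim).congr fun k ↦ ?_
    rw [← hmk k, CurveClass.dist_mk_mk, dist_comm]
  set δ : ℕ → ℝ := fun k ↦ dist c (c' k) + 1 / ((k : ℝ) + 1) with hδ
  have hδlim : Tendsto δ atTop (𝓝 0) := by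
    have h := hdist.add tendsto_one_div_add_atTop_nhds_zero_nat
    rw [add_zero] at h
    exact h
  have hex : ∀ k, ∃ φ : I ≃o I,
      dist c.toContinuousMap ((c' k).reparam φ).toContinuousMap < δ k := fun k ↦
    Curve.exists_dist_reparam_lt (lt_add_of_pos_right _ (by positivity))
  choose φ hφ using hex
  have hpt : ∀ k (w : I), dist (c w) (c' k (φ k w)) < δ k := fun k w ↦
    (ContinuousMap.dist_apply_le_dist (f := c.toContinuousMap)
      (g := ((c' k).reparam (φ k)).toContinuousMap) w).trans_lt (hφ k)
  -- pulled-back witnesses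
  set s' : ℕ → I := fun k ↦ (φ k).symm (s k) with hs'
  set t' : ℕ → I := fun k ↦ (φ k).symm (t k) with ht'
  set u' : ℕ → I := fun k ↦ (φ k).symm (u k) with hu'
  set v' : ℕ → I := fun k ↦ (φ k).symm (v k) with hv'
  have hφs : ∀ k, φ k (s' k) = s k := fun k ↦ (φ k).apply_symm_apply _
  have hφt : ∀ k, φ k (t' k) = t k := fun k ↦ (φ k).apply_symm_apply _
  have hφu : ∀ k, φ k (u' k) = u k := fun k ↦ (φ k).apply_symm_apply _
  have hφv : ∀ k, φ k (v' k) = v k := fun k ↦ (φ k).apply_symm_apply _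
  have hs't' : ∀ k, s' k ≤ t' k := fun k ↦ (φ k).symm.monotone (hst k)
  have hs'u' : ∀ k, s' k ≤ u' k := fun k ↦ (φ k).symm.monotone (hu k).1
  have hu't' : ∀ k, u' k ≤ t' k := fun k ↦ (φ k).symm.monotone (hu k).2
  have hs'v' : ∀ k, s' k ≤ v' k := fun k ↦ (φ k).symm.monotone (hv k).1
  have hv't' : ∀ k, v' k ≤ t' k := fun k ↦ (φ k).symm.monotone (hv k).2
  -- centres and radii in compact ranges
  set mK : ℕ → Metric.closedBall (0 : ℂ) n := fun k ↦ ⟨m k, by simpa using hm k⟩ with hmK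
  set RK : ℕ → Icc (1 / ((n : ℝ) + 1)) (n : ℝ) := fun k ↦ ⟨R k, hR k⟩ with hRK
  obtain ⟨⟨⟨⟨s₀, t₀⟩, ⟨u₀, v₀⟩⟩, ⟨m₀, R₀⟩⟩, ψ, hψ, hlim'⟩ :=
    CompactSpace.tendsto_subseq fun k ↦ (((s' k, t' k), (u' k, v' k)), (mK k, RK k))
  have hs₀ : Tendsto (fun k ↦ s' (ψ k)) atTop (𝓝 s₀) := hlim'.fst_nhds.fst_nhds.fst_nhds
  have ht₀ : Tendsto (fun k ↦ t' (ψ k)) atTop (𝓝 t₀) := hlim'.fst_nhds.fst_nhds.snd_nhds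
  have hu₀ : Tendsto (fun k ↦ u' (ψ k)) atTop (𝓝 u₀) := hlim'.fst_nhds.snd_nhds.fst_nhds
  have hv₀ : Tendsto (fun k ↦ v' (ψ k)) atTop (𝓝 v₀) := hlim'.fst_nhds.snd_nhds.snd_nhds
  have hm₀ : Tendsto (fun k ↦ m (ψ k)) atTop (𝓝 (m₀ : ℂ)) :=
    (continuous_subtype_val.tendsto _).comp hlim'.snd_nhds.fst_nhds
  have hR₀ : Tendsto (fun k ↦ R (ψ k)) atTop (𝓝 (R₀ : ℝ)) :=
    (continuous_subtype_val.tendsto _).comp hlim'.snd_nhds.snd_nhds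
  -- evaluation along the subsequence converges to `c`
  have hkey : ∀ {w : ℕ → I} {w₀ : I}, Tendsto w atTop (𝓝 w₀) →
      Tendsto (fun k ↦ c' (ψ k) (φ (ψ k) (w k))) atTop (𝓝 (c w₀)) := by
    intro w w₀ hw
    rw [tendsto_iff_dist_tendsto_zero]
    have h1 : Tendsto (fun k ↦ dist (c (w k)) (c w₀)) atTop (𝓝 0) :=
      tendsto_iff_dist_tendsto_zero.1 ((c.continuous.tendsto w₀).comp hw)
    have h2 : Tendsto (fun k ↦ δ (ψ k)) atTop (𝓝 0) := hδlim.comp hψ.tendsto_atTop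
    refine squeeze_zero (fun _ ↦ dist_nonneg) (fun k ↦ ?_) (by simpa using h2.add h1)
    calc dist (c' (ψ k) (φ (ψ k) (w k))) (c w₀)
        ≤ dist (c' (ψ k) (φ (ψ k) (w k))) (c (w k)) + dist (c (w k)) (c w₀) :=
          dist_triangle _ _ _
      _ ≤ δ (ψ k) + dist (c (w k)) (c w₀) := by
          gcongr
          rw [dist_comm]
          exact (hpt (ψ k) (w k)).le
  -- limits of the order relations
  have h₀st : s₀ ≤ t₀ := le_of_tendsto_of_tendsto' hs₀ ht₀ fun k ↦ hs't' (ψ k)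
  have h₀su : s₀ ≤ u₀ := le_of_tendsto_of_tendsto' hs₀ hu₀ fun k ↦ hs'u' (ψ k)
  have h₀ut : u₀ ≤ t₀ := le_of_tendsto_of_tendsto' hu₀ ht₀ fun k ↦ hu't' (ψ k)
  have h₀sv : s₀ ≤ v₀ := le_of_tendsto_of_tendsto' hs₀ hv₀ fun k ↦ hs'v' (ψ k)
  have h₀vt : v₀ ≤ t₀ := le_of_tendsto_of_tendsto' hv₀ ht₀ fun k ↦ hv't' (ψ k)
  -- the sphere condition passes to the limit
  have hsph₀ : ∀ w ∈ Icc s₀ t₀, dist (c w) m₀ = R₀ := by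
    intro w hw
    set wk : ℕ → I := fun k ↦ max (s' (ψ k)) (min w (t' (ψ k))) with hwk
    have hwlim : Tendsto wk atTop (𝓝 w) := by
      have : Tendsto wk atTop (𝓝 (max s₀ (min w t₀))) := hs₀.max (tendsto_const_nhds.min ht₀)
      rwa [min_eq_left hw.2, max_eq_right hw.1] at this
    have hconv : Tendsto (fun k ↦ dist (c' (ψ k) (φ (ψ k) (wk k))) (m (ψ k))) atTop
        (𝓝 (dist (c w) m₀)) := (hkey hwlim).dist hm₀
    have heq : ∀ k, dist (c' (ψ k) (φ (ψ k) (wk k))) (m (ψ k)) = R (ψ k) := by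
      intro k
      refine hsph (ψ k) _ ⟨?_, ?_⟩
      · have := (φ (ψ k)).monotone (le_max_left (s' (ψ k)) (min w (t' (ψ k))))
        rwa [hφs] at this
      · have := (φ (ψ k)).monotone (max_le (hs't' (ψ k)) (min_le_right w (t' (ψ k))))
        rwa [hφt] at this
    exact tendsto_nhds_unique (hconv.congr heq) hR₀
  have hεlim : 1 / ((n : ℝ) + 1) ≤ dist (c u₀) (c v₀) := by
    refine ge_of_tendsto' ((hkey hu₀).dist (hkey hv₀)) fun k ↦ ?_
    change 1 / ((n : ℝ) + 1) ≤ dist (c' (ψ k) (φ (ψ k) (u' (ψ k)))) (c' (ψ k) (φ (ψ k) (v' (ψ k))))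
    rw [hφu, hφv]
    exact hε (ψ k)
  exact ⟨c, rfl, s₀, t₀, h₀st, m₀, mem_closedBall_zero_iff.1 m₀.2, R₀, R₀.2, hsph₀, u₀, ⟨h₀su, h₀ut⟩, v₀,
    ⟨h₀sv, h₀vt⟩, hεlim⟩

/-- **The cocircular-tracing event is Borel**: classes with a representative mapping some
parameter interval `[s, t]`, `s < t`, non-constantly into a circle of positive radius.
[cite: AizenmanBurchard1999, §2.1] -/
theorem CurveClass.measurableSet_setOf_tracesCircle :
    MeasurableSet {γ : CurveClass ℂ | ∃ c : Curve ℂ, CurveClass.mk c = γ ∧ ∃ s t : I, s < t ∧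
      ∃ m : ℂ, ∃ R : ℝ, 0 < R ∧ (c : I → ℂ) '' Icc s t ⊆ sphere m R ∧
        ¬ ((c : I → ℂ) '' Icc s t).Subsingleton} := by
  have heq : {γ : CurveClass ℂ | ∃ c : Curve ℂ, CurveClass.mk c = γ ∧ ∃ s t : I, s < t ∧
      ∃ m : ℂ, ∃ R : ℝ, 0 < R ∧ (c : I → ℂ) '' Icc s t ⊆ sphere m R ∧
        ¬ ((c : I → ℂ) '' Icc s t).Subsingleton} =
      ⋃ n : ℕ, {γ : CurveClass ℂ | ∃ c : Curve ℂ, CurveClass.mk c = γ ∧ ∃ s t : I, s ≤ t ∧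
        ∃ m : ℂ, ‖m‖ ≤ n ∧ ∃ R : ℝ, R ∈ Icc (1 / ((n : ℝ) + 1)) n ∧
        (∀ w ∈ Icc s t, dist (c w) m = R) ∧
        ∃ u ∈ Icc s t, ∃ v ∈ Icc s t, 1 / ((n : ℝ) + 1) ≤ dist (c u) (c v)} := by
    ext γ
    simp only [mem_setOf_eq, mem_iUnion]
    constructor
    · rintro ⟨c, hc, s, t, hst, m, R, hR, hsub, hns⟩
      obtain ⟨_, ⟨u, hu, rfl⟩, _, ⟨v, hv, rfl⟩, hne⟩ := not_subsingleton_iff.1 hns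
      -- a common bound `n`
      obtain ⟨n₁, hn₁⟩ := exists_nat_one_div_lt (dist_pos.2 hne)
      obtain ⟨n₂, hn₂⟩ := exists_nat_one_div_lt hR
      obtain ⟨n₃, hn₃⟩ := exists_nat_ge (max ‖m‖ R)
      set n := max n₁ (max n₂ n₃) with hn
      have hmono : ∀ {a b : ℕ}, a ≤ b → 1 / ((b : ℝ) + 1) ≤ 1 / ((a : ℝ) + 1) := fun {a b} hab ↦ by
        apply one_div_le_one_div_of_le (by positivity)
        exact_mod_cast Nat.succ_le_succ hab
      have h1 : n₁ ≤ n := le_max_left _ _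
      have h2 : n₂ ≤ n := (le_max_left _ _).trans (le_max_right _ _)
      have h3 : n₃ ≤ n := (le_max_right _ _).trans (le_max_right _ _)
      have hn₃' : (n₃ : ℝ) ≤ n := by exact_mod_cast h3
      refine ⟨n, c, hc, s, t, hst.le, m, ?_, R, ⟨?_, ?_⟩, fun w hw ↦ ?_, u, hu, v, hv, ?_⟩
      · exact ((le_max_left _ _).trans hn₃).trans hn₃'
      · exact ((hmono h2).trans hn₂.le)
      · exact ((le_max_right _ _).trans hn₃).trans hn₃'
      · exact hsub ⟨w, hw, rfl⟩
      · exact (hmono h1).trans hn₁.le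
    · rintro ⟨n, c, hc, s, t, hst, m, -, R, hR, hsph, u, hu, v, hv, hn⟩
      have hne : c u ≠ c v := dist_pos.1 (lt_of_lt_of_le (by positivity) hn)
      have huv : u ≠ v := fun h ↦ hne (h ▸ rfl)
      have hRpos : 0 < R := lt_of_lt_of_le (by positivity) hR.1
      refine ⟨c, hc, s, t, ?_, m, R, hRpos, ?_, fun hsing ↦ hne (hsing ⟨u, hu, rfl⟩ ⟨v, hv, rfl⟩)⟩
      · rcases hst.lt_or_eq with hlt | rfl
        · exact hlt
        · exact absurd (le_antisymm (hu.2.trans hv.1) (hv.2.trans hu.1)) huv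
      · rintro _ ⟨w, hw, rfl⟩
        exact hsph w hw
  rw [heq]
  exact MeasurableSet.iUnion fun n ↦ (CurveClass.isClosed_setOf_subarc_sphere n).measurableSet

end TracingEvent

/-! ### The SLE_κ curve has no sub-arc image inside a circle, `4 < κ < 8` -/

section SLE

open UpperHalfPlane (upperHalfPlaneSet)

variable {κ : ℝ≥0} {D : DobrushinDomain}

/-- **Almost surely the compactified SLE_κ curve has no sub-arc image inside a circle**,
`4 < κ < 8`. [cite: RohdeSchramm2005, §7] -/
theorem IsSLECurve.ae_forall_not_subset_sphere (hκ4 : 4 < κ) (hκ8 : κ < 8)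
    {Γ : (ℝ≥0 → ℝ) → CurveClass ℂ} (hΓ : IsSLECurve κ D Γ) :
    ∀ᵐ ω ∂Process.preWienerMeasure, ∃ c₀ : Curve ℂ, Γ ω = CurveClass.mk c₀ ∧
      ∀ s t : I, s < t → ∀ (m : ℂ) (R : ℝ), 0 < R →
        ¬ (c₀ : I → ℂ) '' Icc s t ⊆ sphere m R := by
  obtain ⟨-, φ, hφ, hae⟩ := hΓ
  filter_upwards [hae, ae_not_injOn_sleTrace hκ4 hκ8] with ω hω harc
  obtain ⟨hgen, c₀, hc₀, himg⟩ := hω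
  refine ⟨c₀, hc₀, fun s t hst m R hR hsub ↦ ?_⟩
  -- notation
  set Φ : ℂ → ℂ := φ.boundaryExtension with hΦdef
  set Φp : ℂ → ℂ := fun z ↦ Φ (Loewner.liftIm 0 z) with hΦpdef
  have hΦpc : Continuous Φp := continuous_boundaryExtension_liftIm φ
  have hΦp_eq : ∀ {z : ℂ}, 0 ≤ z.im → Φp z = Φ z := fun hz ↦ by
    simp only [hΦpdef, Loewner.liftIm_of_le hz]
  have hcontΦγ : Continuous fun τ ↦ Φ (sleTrace κ ω τ) := by
    have : (fun τ ↦ Φ (sleTrace κ ω τ)) = fun τ ↦ Φp (sleTrace κ ω τ) := by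
      funext τ; rw [hΦp_eq (hgen.im_nonneg τ)]
    rw [this]
    exact hΦpc.comp hgen.continuous
  -- the midpoint parameter `mI = (s + t)/2 < 1`
  have hsm : (s : ℝ) < ((s : ℝ) + t) / 2 := by
    have : (s : ℝ) < t := hst
    linarith
  have hmt : ((s : ℝ) + t) / 2 < 1 := by
    have h1 : (t : ℝ) ≤ 1 := t.2.2
    have : (s : ℝ) < t := hst
    linarith
  set mI : I := ⟨((s : ℝ) + t) / 2, by constructor <;> nlinarith [s.2.1, t.2.1, s.2.2, t.2.2]⟩ with hmI
  have hsm' : s < mI := hsm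
  have hmt' : mI ≤ t := by
    change ((s : ℝ) + t) / 2 ≤ t
    have : (s : ℝ) < t := hst
    linarith
  have hm1 : (mI : ℝ) < 1 := hmt
  set a : ℝ≥0 := rayParam s with ha
  set bmax : ℝ≥0 := rayParam mI with hbmax
  have habmax : a < bmax := rayParam_lt_rayParam_of_lt hsm' hm1
  -- a right end `b` such that the piece `Φ(γ[a, b])` stays within distance `< R` of `p₀`
  set p₀ : ℂ := Φ (sleTrace κ ω a) with hp₀
  have hnhds : {τ | dist (Φ (sleTrace κ ω τ)) p₀ < R} ∈ 𝓝 a := by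
    refine hcontΦγ.continuousAt.preimage_mem_nhds (Metric.isOpen_ball.mem_nhds ?_)
    rw [Metric.mem_ball, hp₀, dist_self]
    exact hR
  obtain ⟨b, hab, hbmax', hsubR⟩ := Loewner.exists_Icc_subset_of_mem_nhds habmax hnhds
  -- the piece is inside `c₀ '' [s, t]`, hence in the sphere
  have hpiece : ∀ τ ∈ Icc a b, Φ (sleTrace κ ω τ) ∈ (c₀ : I → ℂ) '' Icc s t := by
    intro τ hτ
    set u : I := ⟨(τ : ℝ) / (1 + τ), rayParamInv_mem_Icc τ⟩ with hu
    have hτu : rayParam u = τ := rayParam_rayParamInv τ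
    have hu1 : (u : ℝ) < 1 := rayParamInv_lt_one τ
    have hsu : s ≤ u := by
      by_contra hcon
      push Not at hcon
      have := rayParam_lt_rayParam_of_lt hcon (lt_of_le_of_lt (show (s : ℝ) ≤ mI from hsm'.le) hm1)
      rw [hτu] at this
      exact absurd hτ.1 (not_le.2 this)
    have hum : u ≤ mI := by
      by_contra hcon
      push Not at hcon
      have := rayParam_lt_rayParam_of_lt hcon hu1
      rw [hτu] at this
      exact absurd (hτ.2.trans hbmax'.le) (not_le.2 this)
    refine ⟨u, ⟨hsu, hum.trans hmt'⟩, ?_⟩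
    rw [himg.1 u hu1, hτu]
  have hsphere : ∀ τ ∈ Icc a b, ‖Φ (sleTrace κ ω τ) - m‖ = R := fun τ hτ ↦ by
    have h := hsub (hpiece τ hτ)
    rwa [mem_sphere, dist_eq_norm] at h
  -- the tangential coordinate at `p₀`
  set uvec : ℂ := p₀ - m with huvec
  have hunorm : ‖uvec‖ = R := by
    rw [huvec]; exact hsphere a ⟨le_rfl, hab.le⟩
  have hune : uvec ≠ 0 := by
    intro h0
    rw [h0, norm_zero] at hunorm
    exact hR.ne hunorm
  set ρ : ℂ → ℝ := fun z ↦ ((Φp z - m) * (starRingEnd ℂ) uvec).im with hρdef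
  have hρc : Continuous ρ :=
    Complex.continuous_im.comp ((hΦpc.sub continuous_const).mul continuous_const)
  have hinjΦ : InjOn Φ {z : ℂ | 0 ≤ z.im} := JordanDomain.injOn_boundaryExtension φ
  refine harc a b hab ρ hρc ?_
  rintro z₁ ⟨τ₁, hτ₁, rfl⟩ z₂ ⟨τ₂, hτ₂, rfl⟩ heq
  have him₁ : 0 ≤ (sleTrace κ ω τ₁).im := hgen.im_nonneg τ₁
  have him₂ : 0 ≤ (sleTrace κ ω τ₂).im := hgen.im_nonneg τ₂
  apply hinjΦ him₁ him₂
  have heq' : ((Φ (sleTrace κ ω τ₁) - m) * (starRingEnd ℂ) uvec).im =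
      ((Φ (sleTrace κ ω τ₂) - m) * (starRingEnd ℂ) uvec).im := by
    have h := heq
    simp only [hρdef, hΦp_eq him₁, hΦp_eq him₂] at h
    exact h
  refine eq_of_tangential_eq hune ?_ ?_ ?_ heq'
  · rw [hsphere τ₁ hτ₁, hsphere τ₂ hτ₂]
  · exact re_pos_of_dist_lt hunorm (hsphere τ₁ hτ₁) (by
      rw [huvec, add_sub_cancel]; exact hsubR hτ₁)
  · exact re_pos_of_dist_lt hunorm (hsphere τ₂ hτ₂) (by
      rw [huvec, add_sub_cancel]; exact hsubR hτ₂)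

end SLE

end Literature.Probability.RandomPlanarGeometry

end
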